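import Mathlib
import Summits.Ventures.PercRepro2.CoinTreeCore
import Summits.Ventures.PercRepro2.CoinOrTailKDefs
import Summits.Ventures.PercRepro2.CoinKSureExample9
import Summits.Ventures.PercRepro2.CoinKSureTailCoins

/-!
# The marker at the tail on the three-entry instance (blind cell PercRepro2, night-2 g15;
NIGHT2-DARC.md §52)

The 15-coin system of `CoinKSureExample9` on `Fin 9` (s = 0, m₁ = 1, m₂ = 2, r₁ = 3, r₂ = 4,
r₃ = 5, a = 6, w = 7, t = 8): row 2′DARC at `a → w` with the OR-vertex `a = 6` itself as a
marker — markers `(6, 1)` (`darc_tail_example9`) and `(6, 6)` (`darc_tail₂_example9`) — for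
EVERY probability vector, no hypothesis, by `darc_of_orTailTreeK_tail_coins` /
`darc_of_orTailTreeK_tail₂_coins` (§52).
-/

namespace Summit.Ventures.PercRepro2.Coin

namespace KSureExample9

open Classical

/-- **Row 2′DARC at `a → w` for the markers `(a, m₁)` — the marker at the tail — on the
three-entry instance, every probability vector.** -/
theorem darc_tail_example9 {R : Type*} [Field R] [LinearOrder R] [IsStrictOrderedRing R]
    (pr : Fin 15 → R) (hp : IsProbVec pr) :
    DARC pr arcsEx9 0 {8} 6 1 6 7 :=
  darc_of_orTailTreeK_tail_coins pr hp sameEnds_ex9 orTailK_ex9 treeCore_ex9 (by decide)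
    (by decide) (by decide) (by decide) (by decide)

/-- **Row 2′DARC at `a → w` for the markers `(a, a)` — both markers at the tail — on the
three-entry instance, every probability vector.** -/
theorem darc_tail₂_example9 {R : Type*} [Field R] [LinearOrder R] [IsStrictOrderedRing R]
    (pr : Fin 15 → R) (hp : IsProbVec pr) :
    DARC pr arcsEx9 0 {8} 6 6 6 7 :=
  darc_of_orTailTreeK_tail₂_coins pr hp sameEnds_ex9 orTailK_ex9 treeCore_ex9 (by decide)
    (by decide) (by decide) (by decide)

end KSureExample9

end Summit.Ventures.PercRepro2.Coin
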